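import Summits.CriticalPhenomena.CardyFormulaZ2.Theorems.CardyMeckeFlipMeckeRigidityFlipExtremalConst
import Summits.CriticalPhenomena.CardyFormulaZ2.Theorems.CardyMeckeFlipMeckeRigidityToggledIntegrand
import Summits.CriticalPhenomena.CardyFormulaZ2.Theorems.CardyMeckeFlipMeckeRigidityCampbellIntegrand
import Summits.CriticalPhenomena.CardyFormulaZ2.Theorems.CardyMeckeFlipMeckeRigidityCrossingHalf

/-!
# Flip-extremal laws have pivotal mass at every non-trivial quad

Route `Summits/CriticalPhenomena/CardyFormulaZ2/Theses/CardyMeckeFlip`, crux `MeckeRigidity`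
(item stmt-CriticalPhenomena-14826), line `registered` (lead c4), support lemma for the uniqueness stubs.

A structural consequence of the flip axioms (ADM)+(F)+(EXT) of the crux that uses NO geometry: the continuum analogue
of "a non-constant Boolean function has positive total influence".  Let `P` be a probability law on `ℋ_D` with an
admissible kernel family `M`, flip-fair at every cutoff and flip-extremal.  If a quad `Q₀` has NULL PIVOTAL MASS at
every cutoff — `M ε S {x | Piv S x Q₀} = 0` for `P`-a.e. `S` and every `ε > 0` — then its crossing event is trivial,
`P(⊞_{Q₀}) ∈ {0, 1}` (`measureReal_crossedEvent_eq_zero_or_one_of_ae_pivotal_null`).  Reason: with no pivotal mass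
the crossing indicator `1_{⊞ Q₀}` is never toggled along the Campbell measure, so it passes through the flip identity
((F) applied to the appended family `Fin.append Q (fun _ => Q₀)`, `IsFlipFairKernel.integral_indicator_crossedEvent_mul_eq`
— the a.e. twin of cylinder locality), hence is a weakly flip-invariant `[0,1]`-density, hence a.s. constant by
flip-extremality (`ae_eq_const_of_isFlipExtremal`, file `…FlipExtremalConst`).  With (E2)+(D) the crossing
probability of a quad admitting a transposing isometry is `1/2` (file `…CrossingHalf`), so such quads carry pivotal
mass at some cutoff in EVERY model of the six clauses (`exists_pivotalMass_of_transposing_isometry`): the flip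
dynamics of a model is never idle on macroscopic crossing events.  In particular kernels charging only points that
are pivotal for configuration-dependent quads (e.g. vertices of a random tessellation) never give a model — the typed
(EXT) excludes every such "lazy-kernel" law, which is why no counter-model of the crux is constructible from smooth
random colourings.
-/

noncomputable section

open MeasureTheory Set Filter
open Literature.Probability.Percolation Literature.Probability.Percolation.QuadCrossing

namespace Summit.CriticalPhenomena.CardyFormulaZ2.Theorems.CardyMeckeFlip

variable {D : Set ℂ}

/-- **The crossing indicator of a quad with null pivotal mass passes through (F).**  If `K` is a flip-fair kernel for
`P` and `K S` charges no pivotal point of `Q₀` for `P`-a.e. `S`, then for every datum `(Q, g, φ)` of (F)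
`∫ S, 1_{⊞Q₀}(S) * ∫ x, φ x * g {i | Qᵢ ∈ S} ∂(K S) ∂P = ∫ S, 1_{⊞Q₀}(S) * ∫ x, φ x * g (toggled pattern) ∂(K S) ∂P`:
(F) for the appended family `Fin.append Q (fun _ => Q₀)` with test function `g · 1_{0 ∈ ·}`, in which the last
coordinate is `K S`-a.e. never toggled. [folklore] -/
theorem IsFlipFairKernel.integral_indicator_crossedEvent_mul_eq {P : Measure (QuadConfig D)}
    {K : QuadConfig D → Measure ℂ} (hF : IsFlipFairKernel P K) {Q₀ : Quad D}
    (hnull : ∀ᵐ S ∂P, K S {x | S.IsPivotalAt x Q₀} = 0) {n : ℕ} (Q : Fin n → Quad D)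
    (g : Set (Fin n) → ℝ) {φ : ℂ → ℝ} (hφ : Continuous φ) (hφc : HasCompactSupport φ) :
    ∫ S, (QuadConfig.crossedEvent Q₀).indicator 1 S * ∫ x, φ x * g {i | Q i ∈ S} ∂(K S) ∂P =
      ∫ S, (QuadConfig.crossedEvent Q₀).indicator 1 S *
        ∫ x, φ x * g {i | Xor (Q i ∈ S) (S.IsPivotalAt x (Q i))} ∂(K S) ∂P := by
  classical
  set G : Set (Fin 1) → ℝ := fun C => if (0 : Fin 1) ∈ C then 1 else 0 with hG
  have hGind : ∀ S : QuadConfig D, G {_j : Fin 1 | Q₀ ∈ S} =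
      (QuadConfig.crossedEvent Q₀).indicator 1 S := by
    intro S
    by_cases hQ : Q₀ ∈ S
    · simp [hG, hQ]
    · simp [hG, hQ]
  have key := hF (n + 1) (Fin.append Q (fun _ : Fin 1 => Q₀))
    (fun B => g {i | Fin.castAdd 1 i ∈ B} * G {j | Fin.natAdd n j ∈ B}) φ hφ hφc
  simp only [mem_setOf_eq, Fin.append_left, Fin.append_right] at key
  -- untoggled side: the indicator factor is constant in `x`
  have hL : ∀ (S : QuadConfig D) (x : ℂ),
      φ x * (g {i | Q i ∈ S} * G {_j : Fin 1 | Q₀ ∈ S}) =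
        G {_j : Fin 1 | Q₀ ∈ S} * (φ x * g {i | Q i ∈ S}) := fun S x => by ring
  simp only [hL, integral_const_mul] at key
  -- toggled side: `Q₀` is `K S`-a.e. not toggled, for `P`-a.e. `S`
  have hR : ∀ᵐ S ∂P, ∫ x, φ x * (g {i | Xor (Q i ∈ S) (S.IsPivotalAt x (Q i))} *
        G {_j : Fin 1 | Xor (Q₀ ∈ S) (S.IsPivotalAt x Q₀)}) ∂(K S) =
      G {_j : Fin 1 | Q₀ ∈ S} * ∫ x, φ x * g {i | Xor (Q i ∈ S) (S.IsPivotalAt x (Q i))} ∂(K S) := by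
    filter_upwards [hnull] with S hS
    rw [← integral_const_mul]
    refine integral_congr_ae ?_
    have hae : ∀ᵐ x ∂(K S), x ∉ {x | S.IsPivotalAt x Q₀} := measure_eq_zero_iff_ae_notMem.1 hS
    filter_upwards [hae] with x hx
    have hx' : ¬ S.IsPivotalAt x Q₀ := hx
    have hset : {_j : Fin 1 | Xor (Q₀ ∈ S) (S.IsPivotalAt x Q₀)} = {_j : Fin 1 | Q₀ ∈ S} := by
      ext; simp [Xor, hx']
    rw [hset]
    ring
  rw [integral_congr_ae hR] at key
  simpa only [hGind] using key

/-- **Null pivotal mass forces a trivial crossing event.**  For a probability law with an admissible kernel family,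
flip-fair at every cutoff and flip-extremal, a quad whose pivotal set is `M ε S`-null for a.e. `S` at every cutoff
`ε > 0` has crossing probability `0` or `1`: its crossing indicator is a weakly flip-invariant `[0,1]`-density
(`IsFlipFairKernel.integral_indicator_crossedEvent_mul_eq`), hence a.s. constant (`ae_eq_const_of_isFlipExtremal`).
[folklore] -/
theorem measureReal_crossedEvent_eq_zero_or_one_of_ae_pivotal_null {P : Measure (QuadConfig D)}
    [IsProbabilityMeasure P] {M : ℝ → QuadConfig D → Measure ℂ} (hADM : IsAdmissibleKernel P M)
    (hF : ∀ ε : ℝ, 0 < ε → IsFlipFairKernel P (M ε)) (hEXT : IsFlipExtremal P M) (Q₀ : Quad D)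
    (hnull : ∀ ε : ℝ, 0 < ε → ∀ᵐ S ∂P, M ε S {x | S.IsPivotalAt x Q₀} = 0) :
    P.real (QuadConfig.crossedEvent Q₀) = 0 ∨ P.real (QuadConfig.crossedEvent Q₀) = 1 := by
  set h : QuadConfig D → ℝ := (QuadConfig.crossedEvent Q₀).indicator 1 with hh
  have hhm : Measurable h := measurable_one.indicator (QuadConfig.measurableSet_crossedEvent Q₀)
  have hh01 : ∀ S, 0 ≤ h S ∧ h S ≤ 1 := fun S => by
    by_cases hS : S ∈ QuadConfig.crossedEvent Q₀
    · simp [hh, Set.indicator_of_mem hS]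
    · simp [hh, Set.indicator_of_notMem hS]
  have hint : ∀ ε : ℝ, 0 < ε → ∀ (n : ℕ) (Q : Fin n → Quad D) (g : Set (Fin n) → ℝ) (φ : ℂ → ℝ),
      Continuous φ → HasCompactSupport φ →
        Integrable (fun S => ∫ x, φ x * g {i | Q i ∈ S} ∂(M ε S)) P ∧
        Integrable (fun S => ∫ x, φ x * g {i | Xor (Q i ∈ S) (S.IsPivotalAt x (Q i))} ∂(M ε S)) P ∧
        ∫ S, h S * ∫ x, φ x * g {i | Q i ∈ S} ∂(M ε S) ∂P =
          ∫ S, h S * ∫ x, φ x * g {i | Xor (Q i ∈ S) (S.IsPivotalAt x (Q i))} ∂(M ε S) ∂P :=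
    fun ε hε n Q g φ hφ hφc =>
      ⟨integrable_flipFairIntegrand_left D P M hADM ε hε n Q g φ hφ hφc,
        integrable_flipFairIntegrand_right D P M hADM ε hε (hF ε hε) n Q g φ hφ hφc,
        IsFlipFairKernel.integral_indicator_crossedEvent_mul_eq (hF ε hε) (hnull ε hε) Q g hφ hφc⟩
  have hae := ae_eq_const_of_isFlipExtremal hF hEXT hhm hh01 hint
  have hmean : ∫ S, h S ∂P = P.real (QuadConfig.crossedEvent Q₀) :=
    integral_indicator_one (QuadConfig.measurableSet_crossedEvent Q₀)
  haveI : (ae P).NeBot := ae_neBot.2 (IsProbabilityMeasure.ne_zero P)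
  obtain ⟨S, hS⟩ := hae.exists
  rw [hmean] at hS
  simp only at hS
  by_cases hQ : S ∈ QuadConfig.crossedEvent Q₀
  · right
    have : h S = 1 := by simp [hh, Set.indicator_of_mem hQ]
    exact hS.symm.trans this
  · left
    have : h S = 0 := by simp [hh, Set.indicator_of_notMem hQ]
    exact hS.symm.trans this

/-- **Registered form** (sub-goal `crossedEvent_trivial_of_ae_pivotal_null` of item stmt-CriticalPhenomena-14826):
under (ADM)+(F)+(EXT), a quad with null pivotal mass at every cutoff has crossing probability `0` or `1`. [folklore] -/
theorem crossedEvent_trivial_of_ae_pivotal_null : ∀ (D : Set ℂ) (P : Measure (QuadConfig D)) (M : ℝ → QuadConfig D → Measure ℂ), IsProbabilityMeasure P → IsAdmissibleKernel P M → (∀ ε : ℝ, 0 < ε → IsFlipFairKernel P (M ε)) → IsFlipExtremal P M → ∀ Q : Quad D, (∀ ε : ℝ, 0 < ε → ∀ᵐ S ∂P, M ε S {x | S.IsPivotalAt x Q} = 0) → P.real (QuadConfig.crossedEvent Q) = 0 ∨ P.real (QuadConfig.crossedEvent Q) = 1 := by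
  intro D P M hP hADM hF hEXT Q hnull
  exact measureReal_crossedEvent_eq_zero_or_one_of_ae_pivotal_null hADM hF hEXT Q hnull

/-- **Every model has macroscopic pivotal mass** (registered sub-goal `exists_pivotalMass_of_transposing_isometry`
of item stmt-CriticalPhenomena-14826): under (E2)+(D)+(ADM)+(F)+(EXT), a quad admitting a transposing isometry
(an isometry carrying its carrier to itself and side `k` to side `k+1` — e.g. a square and the quarter turn about
its centre) has crossing probability `1/2` (`measureReal_crossedEvent_eq_half`), so by
`measureReal_crossedEvent_eq_zero_or_one_of_ae_pivotal_null` its pivotal set has positive `M ε S`-mass with positive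
probability at some cutoff `ε > 0`. [folklore] -/
theorem exists_pivotalMass_of_transposing_isometry : ∀ (P : Measure (QuadConfig (Set.univ : Set ℂ))) (M : ℝ → QuadConfig (Set.univ : Set ℂ) → Measure ℂ), IsProbabilityMeasure P → (∀ g : ℂ ≃ᵢ ℂ, Measure.map (QuadConfig.isometry g) P = P) → (∀ (n : ℕ) (Q Qt : Fin n → Quad (Set.univ : Set ℂ)), (∀ i, (Qt i).carrier = (Q i).carrier ∧ (Qt i).side 0 = (Q i).side 1 ∧ (Qt i).side 1 = (Q i).side 2 ∧ (Qt i).side 2 = (Q i).side 3 ∧ (Qt i).side 3 = (Q i).side 0) → ∀ A : Set (Set (Fin n)), P {S | {i | Q i ∈ S} ∈ A} = P {S | {i | Qt i ∉ S} ∈ A}) → IsAdmissibleKernel P M → (∀ ε : ℝ, 0 < ε → IsFlipFairKernel P (M ε)) → IsFlipExtremal P M → ∀ (Q : Quad (Set.univ : Set ℂ)) (g : ℂ ≃ᵢ ℂ), (Q.isometry g).carrier = Q.carrier → (Q.isometry g).side 0 = Q.side 1 → (Q.isometry g).side 1 = Q.side 2 → (Q.isometry g).side 2 = Q.side 3 →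 (Q.isometry g).side 3 = Q.side 0 → ∃ ε : ℝ, 0 < ε ∧ ¬ (∀ᵐ S ∂P, M ε S {x | S.IsPivotalAt x Q} = 0) := by
  intro P M hP hE2 hD hADM hF hEXT Q g hc h0 h1 h2 h3
  by_contra hcon'
  have hcon : ∀ ε : ℝ, 0 < ε → ∀ᵐ S ∂P, M ε S {x | S.IsPivotalAt x Q} = 0 := fun ε hε => by
    by_contra h'
    exact hcon' ⟨ε, hε, h'⟩
  have hhalf := measureReal_crossedEvent_eq_half P hE2 hD Q g ⟨hc, h0, h1, h2, h3⟩
  rcases measureReal_crossedEvent_eq_zero_or_one_of_ae_pivotal_null hADM hF hEXT Q hcon with h0' | h1'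
  · rw [h0'] at hhalf; norm_num at hhalf
  · rw [h1'] at hhalf; norm_num at hhalf

end Summit.CriticalPhenomena.CardyFormulaZ2.Theorems.CardyMeckeFlip

end
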